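import Literature.MathematicalPhysics.QuantumFieldTheory.Balaban1983to89.B9SmoothHolderClassPProducers
import Literature.MathematicalPhysics.QuantumFieldTheory.Balaban1983to89.B9SmoothHolderClassPI

/-!
# `Balaban1983to89.B9SmoothHolderClassPProducersR` — THROUGH `R = ϱ(I − P)` FOR ANY WORD ALREADY IN THE TRANSPORTED SITE CLASS: `(I − P)∘Y` and `R∘Y` INTO
# `bHZPG (U(Γ)) w` from `Y` INTO the class, `Y`'s SUP member and (3.49)₁,₂ — `B9SmoothHolderClassPProducers` §4's difference pattern with the Lipschitz word
# `G′∘Z` replaced by an arbitrary class member (the `R`-step, leg (C), of the supply of the certificate's last rows-20–21 Hölder letter `hrgdd13`)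

T. Bałaban, *Propagators for lattice gauge theories in a background field*, Commun. Math. Phys. **99** (1985) 389–434
[`Balaban1985BackgroundPropagators`, "B9"]; [4] = T. Bałaban, *Propagators and renormalization transformations for lattice gauge
theories. II*, Commun. Math. Phys. **96** (1984) 223–250 [`Balaban1984PropagatorsII`].

statement-level skeleton of published theorems with citation tags; proofs where landed; nothing here is a claim about the
Yang–Mills mass gap

THE PRINT.  p. 421: *"It is easy to find estimates for the operator Δ′_π using Theorem 3.1 and the inequality (3.49)"*; (3.49) p. 399: *"|P(x,x′)|,
|(∇_UP)(x,x′)|, |(P∇\*_U)(x,x′)| ≦ O(1){1, (Lʲη)⁻¹, (Lʲη)⁻¹}(L^{j′}η)^{−d}e^{−½δ₀d(y,y′)}"* (P = I − R) and *"we have also the corresponding bounds for Hölder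
norms of the kernel"*; Thm 3.13 p. 426: *"the formulas (3.147), (3.153) permit us to reduce properties of the operators 𝔓, 𝔊 to the corresponding properties of the
operators G′, …, G₁, …"* — the middle term of (3.153) carries the word `R∘D\*∘G₁∘∇\*_{U,μ}`, whose last factor `R` acts on a site field that is in the transported
Hölder class but NOT Lipschitz (it is an order-zero word of G₁ on a Hölder input, (3.44)–(3.45) p. 398).

WHY THIS FILE (cell `pub-ymgap`, node N06, bundle F7 rows 20–21, seat dag-n06-l g32; programme P-HRGDD leg (C), dag-lead g29 WORDS 204; LOCATED-hrgdd, fleet bus I.31524).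
The supply of the certificate's displayed letter `hrgdd13 : HasMaj (bHX ε) (bHW ε′) (R∘D\*∘G₁∘∇\*_μ)` (in print's lossy species since face v1.7 ✓p757146) runs
`R∘D\*∘G₁∘∇\*_μ = Σ_ν R∘J_νᵀ∘[∇_νG₁∇\*_μ]`: the bracket by `B9Thm312WholeMembersRegular.input44∕45_of_stateS` (leg (A)), `J_νᵀ` and the closure into the transported
site class from sup + probe members (leg (B)), then `R` (THIS FILE, leg (C)), assembly (leg (D)).  `B9SmoothHolderClassPProducers` (this lineage, g25) treats
`R∘W = ϱ(W − P∘W)` only for `W` a LIPSCHITZ word `G′∘Z` (§4) or the (3.43) word `G′∇\*_U∘Y` (§5); here `W = Y` is ANY word with (i) a member INTO the class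
`bHZPG (taxiS U) w` and (ii) a SUP member into `𝔠_W^{(−1)}` — `P∘Y` is Lipschitz at the scale Lʲη by (3.49)₂ from the sup member ALONE (§3 `hasMaj_P_comp_into_bHZPG`),
so no gradient of `Y` is ever asked (which is the point: `Y` is Hölder, not Lipschitz).
* ★★ `hasMaj_idSubP_comp_into_bHZPG` — `(I − P)∘Y : b₁ → bHZPG (taxiS U) w`, size `K_Y + CTel ρ K′ K′`, `K′ = C_P·L·C_Y·c`, rate `ρ` (`0 ≤ ρ ≤ ρ_Y`, `ρ + σ + αδ_F ≤ r`);
* ★★ `hasMaj_R_comp_into_bHZPG` — `R∘Y` for `R = ϱ•(I − P)` from the two members of `ϱ•Y` (the scalar is carried by the members, which the consumer produces in the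
  homogeneous currencies `𝔠^{(s)}` ∕ probe readings BEFORE closing into the class — the class size `bHZPG.loc` is subadditive, not assumed homogeneous).
HONEST SCOPE.  Bookkeeping over landed objects ([4] (2.52)–(2.56), (2.60)–(2.61) as typed in `B9PerturbationMajorantAlgebra`; the telescope of g24 through §3 of
`…PProducers`); (3.49) and the member facts enter as HYPOTHESES of printed species — nothing of [B9]∕[4] is asserted; constants ours, not optimised; no pin, no
certificate edit; COUNT-NEUTRAL; N06 NOT discharged; one finite torus at a time — nothing continuum, nothing about OS positivity or the mass gap.  NEW file (a separate
module so that `…PProducers`' importers are not rebuilt); cell `pub-ymgap` (HUMAN RULING D-0062), Track A node N06 [B9], seat `pub-ymgap-dag-n06-l` (g32), 2026-08-30.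
-/

noncomputable section

namespace Literature.MathematicalPhysics.QuantumFieldTheory.Balaban1983to89.B9SmoothHolderClassPProducersR

open B6Geom246MultiLevelTorus (geomT)
open B6GlobalChartV1 (PV blkV1)
open B6Ineq2142KLevelV1 (β lvl)
open B6KLevelCensusIndexV1 (KIdx)
open B6Prop22KLevelTorusCensusEta (nKT)
open B9GeoNormsKLevelV1 (geo9K)
open B9Thm34Ext (toB6)
open B9Thm312Whole (GeoOK cNorm)
open B9Thm312WholeClasses (cNormR)
open B9RWSums343to347Whole (Facts347)
open B11SectG (BlockNorm HasMaj RowSum)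
open B9CoReadingCoords (XBK blkBK)
open B9CoReadingCoordsS (XSK sIK blkSK)
open B9GradViaDivLettersTransported (taxiS)
open B9GeoLemma21KLevelV1 (geo9K_len_pos)
open B9SmoothHolderClassP (bHZP bHZPG bHZP_loc_le_bHZPG)
open B9SmoothHolderClassPI (bHZPI bHZPI_loc bHZPIfam bHZPIfam_of_mem)
open B9PerturbationMajorantAlgebra (hasMaj_weaken hasMaj_sub_exp)
open B9SmoothHolderClassPProducers (CTel hasMaj_P_comp_into_bHZPG)
open Node00 (SiteY FBondY IBondY CfgY toKT)
open Node00.OpsYSectDCoords (DvcoKH)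
open T4RelativeLadder (UnitaryLike)

variable {d ℓ : ℕ} {hd : 1 ≤ d + 1} {hL : Odd (ℓ + 1) ∧ 1 < ℓ + 1} {b₀ b₁ : ℝ}
variable {𝔸 : Type} [NormedRing 𝔸] [NormedAlgebra ℂ 𝔸] [CompleteSpace 𝔸] [FiniteDimensional ℝ 𝔸]
variable {κ : Type} [Fintype κ]
variable (i : KIdx d ℓ hd hL b₀ b₁) [Fintype (geo9K i).Site] (b : Module.Basis κ ℝ 𝔸)

/-! ## §1 Through `R = ϱ(I − P)` for a word already INTO the class -/

section Producers

variable (B : B9.Backgrounds) (cfg : B.Cfg → CfgY 𝔸 i) {R₀ : ℝ} {H₀ : Prop} {bI : FBondY i → IBondY i}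
variable {F₁ : Type} [AddCommGroup F₁] [Module ℝ F₁]
variable {dF : ℕ} {δF α L₀ σ c : ℝ}
variable (w : ℝ → ℝ) (hw0 : ∀ s, 0 ≤ w s) (hw1 : ∀ s, w s ≤ 1)

/-- ★★ **`(I − P)∘Y` INTO THE CLASS FROM `Y` INTO THE CLASS AND `Y`'s SUP MEMBER.**  `Y : b₁ → bHZPG (taxiS U) w` (size `K_Y`, rate `ρ_Y`) AND `Y : b₁ → 𝔠_W^{(−1)}`
(size `C_Y`, same rate); P with its (3.49)₁ sup word (`𝔠_W^{(0)} → 𝔠_W^{(0)}`) and (3.49)₂ sup-gradient word (`D_UP : 𝔠_W^{(0)} → 𝔠^{(1)}`), sizes `C_P`, rate `r` ⟹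
`(I − P)∘Y = Y − P∘Y : b₁ → bHZPG (taxiS U) w` with size `K_Y + CTel ρ K′ K′`, `K′ = C_P·L·C_Y·c`, at any rate `ρ` with `0 ≤ ρ ≤ ρ_Y`, `ρ + σ + αδ_F ≤ r`: the first word is the
member weakened to the rate ρ, the second is Lipschitz at the scale Lʲη from the SUP member alone (`…PProducers.hasMaj_P_comp_into_bHZPG`) — no gradient of `Y` is used.
[cite: Balaban1985BackgroundPropagators, (3.49) p.399 + p.421 («Theorem 3.1 and the inequality (3.49)») + (3.40) p.397 + Thm 3.13 p.426; Balaban1984PropagatorsII, (2.51)–(2.56), (2.60)–(2.61) pp.232–234] -/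
theorem hasMaj_idSubP_comp_into_bHZPG (hG : GeoOK (geo9K i)) (hF : Facts347 (geo9K i) R₀ H₀ dF δF α L₀) (hrow : RowSum (toB6 (geo9K i) R₀ H₀) σ c)
    (hβ1 : ∀ f : FBondY i, (geomT i.D).dist (β i.hN i.D i.hk (bI f)) (blkV1 i.hN i.D f) ≤ 1)
    (hlev : ∀ f : FBondY i, lvl i.hN i.D i.hk (bI f) = (blkV1 i.hN i.D f).1.1)
    (hcf : |i.cf| = (nKT (toKT i) : ℝ)) {U : B.Cfg} (hU : ∀ ν x, UnitaryLike (cfg U ν x))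
    {P : Module.End ℝ (XSK κ i → ℝ)} {b₁ : BlockNorm (toB6 (geo9K i) R₀ H₀) F₁} {Y : F₁ →ₗ[ℝ] (XSK κ i → ℝ)}
    {CP r KY CY ρY ρ : ℝ} (hCP : 0 ≤ CP) (hKY : 0 ≤ KY) (hCY : 0 ≤ CY) (hc : 0 ≤ c) (hρ : 0 ≤ ρ) (hρY : ρ ≤ ρY) (hbud : ρ + σ + α * δF ≤ r)
    (hP : HasMaj (cNormR R₀ H₀ (blkSK i (sIK i bI)) hG.lenle 0) (cNormR R₀ H₀ (blkSK i (sIK i bI)) hG.lenle 0) P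
      (fun a a' => CP * Real.exp (-(r * (geo9K i).dist a a'))))
    (hDvP : HasMaj (cNormR R₀ H₀ (blkSK i (sIK i bI)) hG.lenle 0) (cNormR R₀ H₀ (blkBK i bI) hG.lenle 1) (DvcoKH i b B cfg U ∘ₗ P)
      (fun a a' => CP * Real.exp (-(r * (geo9K i).dist a a'))))
    (hYcl : HasMaj b₁ (bHZPG (κ := κ) i b (taxiS i B cfg U) (R := R₀) (H := H₀) w hw0 hw1) Y
      (fun a a' => KY * Real.exp (-(ρY * (geo9K i).dist a a'))))
    (hYsup : HasMaj b₁ (cNormR R₀ H₀ (blkSK i (sIK i bI)) hG.lenle (-1)) Y (fun a a' => CY * Real.exp (-(ρY * (geo9K i).dist a a')))) :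
    HasMaj b₁ (bHZPG (κ := κ) i b (taxiS i B cfg U) (R := R₀) (H := H₀) w hw0 hw1) ((LinearMap.id - P) ∘ₗ Y)
      (fun a a' => (KY + CTel d ℓ b ρ (CP * (geo9K i).L * CY * c) (CP * (geo9K i).L * CY * c)) * Real.exp (-(ρ * (geo9K i).dist a a'))) := by
  -- the member itself, weakened to the rate ρ
  have h1 : HasMaj b₁ (bHZPG (κ := κ) i b (taxiS i B cfg U) (R := R₀) (H := H₀) w hw0 hw1) Y
      (fun a a' => KY * Real.exp (-(ρ * (geo9K i).dist a a'))) := hasMaj_weaken hG hKY le_rfl hρY hYcl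
  -- P∘Y INTO the class: Lipschitz at scale Lʲη from the sup member alone
  have h2 := hasMaj_P_comp_into_bHZPG i b B cfg w hw0 hw1 hG hF hrow hβ1 hlev hcf hU hCP hCY hc hρ hρY hbud hP hDvP hYsup
  refine (hasMaj_sub_exp h1 h2).congr fun μ => ?_
  simp only [LinearMap.sub_apply, LinearMap.comp_apply, LinearMap.id_apply]

/-- ★★ **`R∘Y` INTO THE CLASS** (`R = ϱ•(I − P)`, ϱ the model's scalar, any sign) FROM THE TWO MEMBERS OF `ϱ•Y`: since `R∘Y = (I − P)∘(ϱ•Y)`, the previous lemma at `ϱ•Y`.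
The consumer produces the members of `ϱ•Y` in the homogeneous currencies (`𝔠^{(s)}` sup members, probe readings) before closing into the class; the class size itself
is only subadditive. Size `K + CTel ρ K′ K′`, `K′ = C_P·L·C·c`, where `K`, `C` are the sizes of `ϱ•Y`'s class member and sup member.
[cite: Balaban1985BackgroundPropagators, (3.49) p.399 + p.421 + Thm 3.13 (3.152)–(3.153) p.426; Balaban1984PropagatorsII, (2.51)–(2.56), (2.60)–(2.61) pp.232–234] -/
theorem hasMaj_R_comp_into_bHZPG (hG : GeoOK (geo9K i)) (hF : Facts347 (geo9K i) R₀ H₀ dF δF α L₀) (hrow : RowSum (toB6 (geo9K i) R₀ H₀) σ c)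
    (hβ1 : ∀ f : FBondY i, (geomT i.D).dist (β i.hN i.D i.hk (bI f)) (blkV1 i.hN i.D f) ≤ 1)
    (hlev : ∀ f : FBondY i, lvl i.hN i.D i.hk (bI f) = (blkV1 i.hN i.D f).1.1)
    (hcf : |i.cf| = (nKT (toKT i) : ℝ)) {U : B.Cfg} (hU : ∀ ν x, UnitaryLike (cfg U ν x))
    {P R : Module.End ℝ (XSK κ i → ℝ)} {b₁ : BlockNorm (toB6 (geo9K i) R₀ H₀) F₁} {Y : F₁ →ₗ[ℝ] (XSK κ i → ℝ)}
    {CP ϱ r K C ρY ρ : ℝ} (hCP : 0 ≤ CP) (hK : 0 ≤ K) (hC : 0 ≤ C) (hc : 0 ≤ c) (hρ : 0 ≤ ρ) (hρY : ρ ≤ ρY) (hbud : ρ + σ + α * δF ≤ r)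
    (hR : R = ϱ • (LinearMap.id - P))
    (hP : HasMaj (cNormR R₀ H₀ (blkSK i (sIK i bI)) hG.lenle 0) (cNormR R₀ H₀ (blkSK i (sIK i bI)) hG.lenle 0) P
      (fun a a' => CP * Real.exp (-(r * (geo9K i).dist a a'))))
    (hDvP : HasMaj (cNormR R₀ H₀ (blkSK i (sIK i bI)) hG.lenle 0) (cNormR R₀ H₀ (blkBK i bI) hG.lenle 1) (DvcoKH i b B cfg U ∘ₗ P)
      (fun a a' => CP * Real.exp (-(r * (geo9K i).dist a a'))))
    (hYcl : HasMaj b₁ (bHZPG (κ := κ) i b (taxiS i B cfg U) (R := R₀) (H := H₀) w hw0 hw1) (ϱ • Y)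
      (fun a a' => K * Real.exp (-(ρY * (geo9K i).dist a a'))))
    (hYsup : HasMaj b₁ (cNormR R₀ H₀ (blkSK i (sIK i bI)) hG.lenle (-1)) (ϱ • Y) (fun a a' => C * Real.exp (-(ρY * (geo9K i).dist a a')))) :
    HasMaj b₁ (bHZPG (κ := κ) i b (taxiS i B cfg U) (R := R₀) (H := H₀) w hw0 hw1) (R ∘ₗ Y)
      (fun a a' => (K + CTel d ℓ b ρ (CP * (geo9K i).L * C * c) (CP * (geo9K i).L * C * c)) * Real.exp (-(ρ * (geo9K i).dist a a'))) := by
  have h := hasMaj_idSubP_comp_into_bHZPG i b B cfg w hw0 hw1 hG hF hrow hβ1 hlev hcf hU hCP hK hC hc hρ hρY hbud hP hDvP hYcl hYsup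
  refine h.congr fun μ => ?_
  simp only [hR, LinearMap.comp_apply, LinearMap.sub_apply, LinearMap.id_apply, LinearMap.smul_apply, map_smul, smul_sub]

end Producers

/-! ## §2 Re-targeting: from the graded class to ONE exponent, print-weighted (`bHZP g s`) and print-exact (`bHZPI g s` ∕ `bHZPIfam g s`) -/

section Retarget

variable (g : SiteY i → SiteY i → 𝔸ˣ) {R : ℝ} {H : Prop}
variable (w : ℝ → ℝ) (hw0 : ∀ s, 0 ≤ w s) (hw1 : ∀ s, w s ≤ 1)
variable {F₁ : Type} [AddCommGroup F₁] [Module ℝ F₁]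

omit [CompleteSpace 𝔸] [FiniteDimensional ℝ 𝔸] in
/-- ★ **INTO ONE EXPONENT FROM INTO THE GRADED CLASS**: a majorant `K ≥ 0` of `T` INTO `bHZPG g w` is the majorant `(w s)⁻¹·K` INTO `bHZP g s` (`0 < s < 1`, `0 < w s`) —
the target twin of `B9SmoothHolderClassP.hasMaj_from_bHZPG`, by `bHZP_loc_le_bHZPG`. [cite: Balaban1985BackgroundPropagators, (3.43)–(3.45) p.398 («B₀(β)», «B′₀(ε,β)»), bookkeeping; Balaban1984PropagatorsII, (2.51) p.232] -/
theorem hasMaj_into_bHZP_of_bHZPG {b₁ : BlockNorm (toB6 (geo9K i) R H) F₁} {T : F₁ →ₗ[ℝ] (XSK κ i → ℝ)} {K : IBondY i → IBondY i → ℝ}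
    {s : ℝ} (hs0 : 0 < s) (hs1 : s < 1) (hws : 0 < w s)
    (h : HasMaj b₁ (bHZPG (κ := κ) i b g (R := R) (H := H) w hw0 hw1) T K) :
    HasMaj b₁ (bHZP (κ := κ) i b g (R := R) (H := H) (s := s) hs0.le hs1.le) T (fun y y' => (w s)⁻¹ * K y y') := by
  intro y' μ hμ y
  show _ ≤ (w s)⁻¹ * K y y' * b₁.loc y' μ
  have h1 := h y' μ hμ y
  have h2 := bHZP_loc_le_bHZPG (R := R) (H := H) i b g w hw0 hw1 hs0 hs1 hws y (T μ)
  calc (bHZP (κ := κ) i b g (R := R) (H := H) (s := s) hs0.le hs1.le).loc y (T μ)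
      ≤ (w s)⁻¹ * (bHZPG (κ := κ) i b g (R := R) (H := H) w hw0 hw1).loc y (T μ) := h2
    _ ≤ (w s)⁻¹ * (K y y' * b₁.loc y' μ) := mul_le_mul_of_nonneg_left h1 (inv_nonneg.mpr (hw0 s))
    _ = (w s)⁻¹ * K y y' * b₁.loc y' μ := (mul_assoc _ _ _).symm

omit [CompleteSpace 𝔸] [FiniteDimensional ℝ 𝔸] in
/-- ★ **INTO THE PRINT-EXACT CLASS `bHZPI g s` (= `Lʲη·bHZP g s`, dag-n06-c's `bHXT` slot) FROM INTO THE GRADED CLASS**: the majorant picks up the target's block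
length, `Lʲη·(w s)⁻¹·K`. [cite: Balaban1985BackgroundPropagators, (3.40) p.397 + (3.44)–(3.45) p.398, bookkeeping; Balaban1984PropagatorsII, (2.60) p.234] -/
theorem hasMaj_into_bHZPI_of_bHZPG {b₁ : BlockNorm (toB6 (geo9K i) R H) F₁} {T : F₁ →ₗ[ℝ] (XSK κ i → ℝ)} {K : IBondY i → IBondY i → ℝ}
    {s : ℝ} (hs0 : 0 < s) (hs1 : s < 1) (hws : 0 < w s)
    (h : HasMaj b₁ (bHZPG (κ := κ) i b g (R := R) (H := H) w hw0 hw1) T K) :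
    HasMaj b₁ (bHZPI (κ := κ) i b g (R := R) (H := H) (s := s) hs0.le hs1.le) T (fun y y' => (geo9K i).len y * ((w s)⁻¹ * K y y')) := by
  intro y' μ hμ y
  show _ ≤ (geo9K i).len y * ((w s)⁻¹ * K y y') * b₁.loc y' μ
  have h1 := hasMaj_into_bHZP_of_bHZPG i b g w hw0 hw1 hs0 hs1 hws h y' μ hμ y
  rw [bHZPI_loc]
  calc (geo9K i).len y * (bHZP (κ := κ) i b g (R := R) (H := H) (s := s) hs0.le hs1.le).loc y (T μ)
      ≤ (geo9K i).len y * ((w s)⁻¹ * K y y' * b₁.loc y' μ) := mul_le_mul_of_nonneg_left h1 (geo9K_len_pos i y).le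
    _ = (geo9K i).len y * ((w s)⁻¹ * K y y') * b₁.loc y' μ := by ring

omit [CompleteSpace 𝔸] [FiniteDimensional ℝ 𝔸] in
/-- the same INTO the total family `bHZPIfam g s` (the certificate's `bHXT x U s`) for `0 < s < 1`. [cite: Balaban1985BackgroundPropagators, (3.44)–(3.45) p.398, bookkeeping] -/
theorem hasMaj_into_bHZPIfam_of_bHZPG {b₁ : BlockNorm (toB6 (geo9K i) R H) F₁} {T : F₁ →ₗ[ℝ] (XSK κ i → ℝ)} {K : IBondY i → IBondY i → ℝ}
    {s : ℝ} (hs0 : 0 < s) (hs1 : s < 1) (hws : 0 < w s)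
    (h : HasMaj b₁ (bHZPG (κ := κ) i b g (R := R) (H := H) w hw0 hw1) T K) :
    HasMaj b₁ (bHZPIfam (κ := κ) i b g (R := R) (H := H) s) T (fun y y' => (geo9K i).len y * ((w s)⁻¹ * K y y')) := by
  rw [bHZPIfam_of_mem i b g hs0.le hs1.le]
  exact hasMaj_into_bHZPI_of_bHZPG i b g w hw0 hw1 hs0 hs1 hws h

end Retarget

/-! ## §3 (edition 2) The single-exponent twins: `P∘X`, `(I − P)∘Y`, `R∘Y` INTO the print-weighted class `bHZP g s` and the print-exact `bHZPI g s` ∕ `bHZPIfam g s`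
(the currency of dag-n06-c's transported-class legs, which close INTO one exponent from sup + probe members) -/

section SingleExponent

open B9PerturbationMajorantAlgebra (hasMaj_shift hasMaj_comp_cNormR rpow_abs_eq_pow)
open B9SmoothHolderClassTFromGradient (hasMaj_into_bHZT_printWeight_of_grad)

variable (B : B9.Backgrounds) (cfg : B.Cfg → CfgY 𝔸 i) {R₀ : ℝ} {H₀ : Prop} {bI : FBondY i → IBondY i}
variable {F₁ : Type} [AddCommGroup F₁] [Module ℝ F₁]
variable {dF : ℕ} {δF α L₀ σ c : ℝ}

/-- ★ **THE LIPSCHITZ WORD `P∘X` INTO ONE EXPONENT `bHZP (taxiS U) s`** (`0 ≤ s ≤ 1`): `…PProducers.hasMaj_P_comp_into_bHZPG`'s text with the last step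
`B9SmoothHolderClassTFromGradient.hasMaj_into_bHZT_printWeight_of_grad` (the print-weighted single-exponent telescope) instead of the graded one; same size `CTel ρ K K`,
`K = C_P·L·C_X·c`. [cite: Balaban1985BackgroundPropagators, (3.49) p.399 + (3.40) p.397 + p.421; Balaban1984PropagatorsII, (2.51)–(2.54), (2.60)–(2.61) pp.232–234] -/
theorem hasMaj_P_comp_into_bHZP {s : ℝ} (hs0 : 0 ≤ s) (hs1 : s ≤ 1)
    (hG : GeoOK (geo9K i)) (hF : Facts347 (geo9K i) R₀ H₀ dF δF α L₀) (hrow : RowSum (toB6 (geo9K i) R₀ H₀) σ c)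
    (hβ1 : ∀ f : FBondY i, (geomT i.D).dist (β i.hN i.D i.hk (bI f)) (blkV1 i.hN i.D f) ≤ 1)
    (hlev : ∀ f : FBondY i, lvl i.hN i.D i.hk (bI f) = (blkV1 i.hN i.D f).1.1)
    (hcf : |i.cf| = (nKT (toKT i) : ℝ)) {U : B.Cfg} (hU : ∀ ν x, UnitaryLike (cfg U ν x))
    {P : Module.End ℝ (XSK κ i → ℝ)} {b₁ : BlockNorm (toB6 (geo9K i) R₀ H₀) F₁} {X : F₁ →ₗ[ℝ] (XSK κ i → ℝ)}
    {CP r CX ρX ρ : ℝ} (hCP : 0 ≤ CP) (hCX : 0 ≤ CX) (hc : 0 ≤ c) (hρ : 0 ≤ ρ) (hρX : ρ ≤ ρX) (hbud : ρ + σ + α * δF ≤ r)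
    (hP : HasMaj (cNormR R₀ H₀ (blkSK i (sIK i bI)) hG.lenle 0) (cNormR R₀ H₀ (blkSK i (sIK i bI)) hG.lenle 0) P
      (fun a a' => CP * Real.exp (-(r * (geo9K i).dist a a'))))
    (hDvP : HasMaj (cNormR R₀ H₀ (blkSK i (sIK i bI)) hG.lenle 0) (cNormR R₀ H₀ (blkBK i bI) hG.lenle 1) (DvcoKH i b B cfg U ∘ₗ P)
      (fun a a' => CP * Real.exp (-(r * (geo9K i).dist a a'))))
    (hX : HasMaj b₁ (cNormR R₀ H₀ (blkSK i (sIK i bI)) hG.lenle (-1)) X (fun a a' => CX * Real.exp (-(ρX * (geo9K i).dist a a')))) :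
    HasMaj b₁ (bHZP (κ := κ) i b (taxiS i B cfg U) (R := R₀) (H := H₀) (s := s) hs0 hs1) (P ∘ₗ X)
      (fun a a' => CTel d ℓ b ρ (CP * (geo9K i).L * CX * c) (CP * (geo9K i).L * CX * c) * Real.exp (-(ρ * (geo9K i).dist a a'))) := by
  have hL0 : 0 ≤ (geo9K i).L := le_trans zero_le_one hF.one_le_L
  have hK : 0 ≤ CP * (geo9K i).L * CX * c := mul_nonneg (mul_nonneg (mul_nonneg hCP hL0) hCX) hc
  -- P and D_UP shifted by −1
  have hP' := hasMaj_shift hG hF (-1 : ℝ) (by norm_num) hCP hP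
  rw [rpow_abs_eq_pow (geo9K i).L (-1) 1 (by norm_num), pow_one, show (0 : ℝ) + -1 = -1 by norm_num] at hP'
  have hD' := hasMaj_shift hG hF (-1 : ℝ) (by norm_num) hCP hDvP
  rw [rpow_abs_eq_pow (geo9K i).L (-1) 1 (by norm_num), pow_one, show (0 : ℝ) + -1 = -1 by norm_num, show (1 : ℝ) + -1 = 0 by norm_num] at hD'
  have hsup := hasMaj_comp_cNormR hG hrow (mul_nonneg hCP hL0) hCX hρ hρX (show ρ + σ ≤ r - α * δF by linarith) hP' hX
  have hgrad := hasMaj_comp_cNormR hG hrow (mul_nonneg hCP hL0) hCX hρ hρX (show ρ + σ ≤ r - α * δF by linarith) hD' hX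
  have hgrad' : HasMaj b₁ (cNormR R₀ H₀ (blkBK i bI) hG.lenle 0) (DvcoKH i b B cfg U ∘ₗ (P ∘ₗ X))
      (fun a a' => CP * (geo9K i).L * CX * c * Real.exp (-(ρ * (geo9K i).dist a a'))) :=
    hgrad.congr fun μ => rfl
  exact hasMaj_into_bHZT_printWeight_of_grad i b B cfg hG.lenle hs0 hs1 hβ1 hlev hρ hcf hU hK hK hsup hgrad'

/-- ★★ **`(I − P)∘Y` INTO ONE EXPONENT** from `Y` INTO `bHZP (taxiS U) s` (size `K_Y`, rate `ρ_Y`), `Y`'s sup member INTO `𝔠_W^{(−1)}` (size `C_Y`) and P's (3.49)₁,₂: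
size `K_Y + CTel ρ K′ K′`, `K′ = C_P·L·C_Y·c`, rate ρ (`0 ≤ ρ ≤ ρ_Y`, `ρ + σ + αδ_F ≤ r`) — §1's `hasMaj_idSubP_comp_into_bHZPG` at one exponent.
[cite: Balaban1985BackgroundPropagators, (3.49) p.399 + p.421 + Thm 3.13 p.426; Balaban1984PropagatorsII, (2.51)–(2.56), (2.60)–(2.61) pp.232–234] -/
theorem hasMaj_idSubP_comp_into_bHZP {s : ℝ} (hs0 : 0 ≤ s) (hs1 : s ≤ 1)
    (hG : GeoOK (geo9K i)) (hF : Facts347 (geo9K i) R₀ H₀ dF δF α L₀) (hrow : RowSum (toB6 (geo9K i) R₀ H₀) σ c)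
    (hβ1 : ∀ f : FBondY i, (geomT i.D).dist (β i.hN i.D i.hk (bI f)) (blkV1 i.hN i.D f) ≤ 1)
    (hlev : ∀ f : FBondY i, lvl i.hN i.D i.hk (bI f) = (blkV1 i.hN i.D f).1.1)
    (hcf : |i.cf| = (nKT (toKT i) : ℝ)) {U : B.Cfg} (hU : ∀ ν x, UnitaryLike (cfg U ν x))
    {P : Module.End ℝ (XSK κ i → ℝ)} {b₁ : BlockNorm (toB6 (geo9K i) R₀ H₀) F₁} {Y : F₁ →ₗ[ℝ] (XSK κ i → ℝ)}
    {CP r KY CY ρY ρ : ℝ} (hCP : 0 ≤ CP) (hKY : 0 ≤ KY) (hCY : 0 ≤ CY) (hc : 0 ≤ c) (hρ : 0 ≤ ρ) (hρY : ρ ≤ ρY) (hbud : ρ + σ + α * δF ≤ r)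
    (hP : HasMaj (cNormR R₀ H₀ (blkSK i (sIK i bI)) hG.lenle 0) (cNormR R₀ H₀ (blkSK i (sIK i bI)) hG.lenle 0) P
      (fun a a' => CP * Real.exp (-(r * (geo9K i).dist a a'))))
    (hDvP : HasMaj (cNormR R₀ H₀ (blkSK i (sIK i bI)) hG.lenle 0) (cNormR R₀ H₀ (blkBK i bI) hG.lenle 1) (DvcoKH i b B cfg U ∘ₗ P)
      (fun a a' => CP * Real.exp (-(r * (geo9K i).dist a a'))))
    (hYcl : HasMaj b₁ (bHZP (κ := κ) i b (taxiS i B cfg U) (R := R₀) (H := H₀) (s := s) hs0 hs1) Y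
      (fun a a' => KY * Real.exp (-(ρY * (geo9K i).dist a a'))))
    (hYsup : HasMaj b₁ (cNormR R₀ H₀ (blkSK i (sIK i bI)) hG.lenle (-1)) Y (fun a a' => CY * Real.exp (-(ρY * (geo9K i).dist a a')))) :
    HasMaj b₁ (bHZP (κ := κ) i b (taxiS i B cfg U) (R := R₀) (H := H₀) (s := s) hs0 hs1) ((LinearMap.id - P) ∘ₗ Y)
      (fun a a' => (KY + CTel d ℓ b ρ (CP * (geo9K i).L * CY * c) (CP * (geo9K i).L * CY * c)) * Real.exp (-(ρ * (geo9K i).dist a a'))) := by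
  have h1 : HasMaj b₁ (bHZP (κ := κ) i b (taxiS i B cfg U) (R := R₀) (H := H₀) (s := s) hs0 hs1) Y
      (fun a a' => KY * Real.exp (-(ρ * (geo9K i).dist a a'))) := hasMaj_weaken hG hKY le_rfl hρY hYcl
  have h2 := hasMaj_P_comp_into_bHZP i b B cfg hs0 hs1 hG hF hrow hβ1 hlev hcf hU hCP hCY hc hρ hρY hbud hP hDvP hYsup
  refine (hasMaj_sub_exp h1 h2).congr fun μ => ?_
  simp only [LinearMap.sub_apply, LinearMap.comp_apply, LinearMap.id_apply]

/-- ★★ **`R∘Y` INTO ONE EXPONENT** (`R = ϱ•(I − P)`) from the two members of `ϱ•Y` — §1's `hasMaj_R_comp_into_bHZPG` at one exponent `bHZP (taxiS U) s`.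
[cite: Balaban1985BackgroundPropagators, (3.49) p.399 + p.421 + Thm 3.13 (3.152)–(3.153) p.426; Balaban1984PropagatorsII, (2.51)–(2.56), (2.60)–(2.61) pp.232–234] -/
theorem hasMaj_R_comp_into_bHZP {s : ℝ} (hs0 : 0 ≤ s) (hs1 : s ≤ 1)
    (hG : GeoOK (geo9K i)) (hF : Facts347 (geo9K i) R₀ H₀ dF δF α L₀) (hrow : RowSum (toB6 (geo9K i) R₀ H₀) σ c)
    (hβ1 : ∀ f : FBondY i, (geomT i.D).dist (β i.hN i.D i.hk (bI f)) (blkV1 i.hN i.D f) ≤ 1)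
    (hlev : ∀ f : FBondY i, lvl i.hN i.D i.hk (bI f) = (blkV1 i.hN i.D f).1.1)
    (hcf : |i.cf| = (nKT (toKT i) : ℝ)) {U : B.Cfg} (hU : ∀ ν x, UnitaryLike (cfg U ν x))
    {P R : Module.End ℝ (XSK κ i → ℝ)} {b₁ : BlockNorm (toB6 (geo9K i) R₀ H₀) F₁} {Y : F₁ →ₗ[ℝ] (XSK κ i → ℝ)}
    {CP ϱ r K C ρY ρ : ℝ} (hCP : 0 ≤ CP) (hK : 0 ≤ K) (hC : 0 ≤ C) (hc : 0 ≤ c) (hρ : 0 ≤ ρ) (hρY : ρ ≤ ρY) (hbud : ρ + σ + α * δF ≤ r)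
    (hR : R = ϱ • (LinearMap.id - P))
    (hP : HasMaj (cNormR R₀ H₀ (blkSK i (sIK i bI)) hG.lenle 0) (cNormR R₀ H₀ (blkSK i (sIK i bI)) hG.lenle 0) P
      (fun a a' => CP * Real.exp (-(r * (geo9K i).dist a a'))))
    (hDvP : HasMaj (cNormR R₀ H₀ (blkSK i (sIK i bI)) hG.lenle 0) (cNormR R₀ H₀ (blkBK i bI) hG.lenle 1) (DvcoKH i b B cfg U ∘ₗ P)
      (fun a a' => CP * Real.exp (-(r * (geo9K i).dist a a'))))
    (hYcl : HasMaj b₁ (bHZP (κ := κ) i b (taxiS i B cfg U) (R := R₀) (H := H₀) (s := s) hs0 hs1) (ϱ • Y)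
      (fun a a' => K * Real.exp (-(ρY * (geo9K i).dist a a'))))
    (hYsup : HasMaj b₁ (cNormR R₀ H₀ (blkSK i (sIK i bI)) hG.lenle (-1)) (ϱ • Y) (fun a a' => C * Real.exp (-(ρY * (geo9K i).dist a a')))) :
    HasMaj b₁ (bHZP (κ := κ) i b (taxiS i B cfg U) (R := R₀) (H := H₀) (s := s) hs0 hs1) (R ∘ₗ Y)
      (fun a a' => (K + CTel d ℓ b ρ (CP * (geo9K i).L * C * c) (CP * (geo9K i).L * C * c)) * Real.exp (-(ρ * (geo9K i).dist a a'))) := by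
  have h := hasMaj_idSubP_comp_into_bHZP i b B cfg hs0 hs1 hG hF hrow hβ1 hlev hcf hU hCP hK hC hc hρ hρY hbud hP hDvP hYcl hYsup
  refine h.congr fun μ => ?_
  simp only [hR, LinearMap.comp_apply, LinearMap.sub_apply, LinearMap.id_apply, LinearMap.smul_apply, map_smul, smul_sub]

omit [CompleteSpace 𝔸] [FiniteDimensional ℝ 𝔸] in
/-- ★ **FROM `bHZP g s` TO THE PRINT-EXACT `bHZPI g s`** (= `Lʲη·bHZP g s`, dag-n06-c's `bHXT` currency): the majorant picks up the target's block length.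
[cite: Balaban1985BackgroundPropagators, (3.40) p.397 + (3.44)–(3.45) p.398, bookkeeping] -/
theorem hasMaj_into_bHZPI_of_bHZP (g : SiteY i → SiteY i → 𝔸ˣ) {b₁ : BlockNorm (toB6 (geo9K i) R₀ H₀) F₁} {T : F₁ →ₗ[ℝ] (XSK κ i → ℝ)}
    {K : IBondY i → IBondY i → ℝ} {s : ℝ} (hs0 : 0 ≤ s) (hs1 : s ≤ 1)
    (h : HasMaj b₁ (bHZP (κ := κ) i b g (R := R₀) (H := H₀) (s := s) hs0 hs1) T K) :
    HasMaj b₁ (bHZPI (κ := κ) i b g (R := R₀) (H := H₀) (s := s) hs0 hs1) T (fun y y' => (geo9K i).len y * K y y') := by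
  intro y' μ hμ y
  show _ ≤ (geo9K i).len y * K y y' * b₁.loc y' μ
  rw [bHZPI_loc, mul_assoc]
  exact mul_le_mul_of_nonneg_left (h y' μ hμ y) (geo9K_len_pos i y).le

omit [CompleteSpace 𝔸] [FiniteDimensional ℝ 𝔸] in
/-- the same INTO the total family `bHZPIfam g s` (the certificate's `bHXT x U s`), `0 ≤ s ≤ 1`. [cite: Balaban1985BackgroundPropagators, (3.44)–(3.45) p.398, bookkeeping] -/
theorem hasMaj_into_bHZPIfam_of_bHZP (g : SiteY i → SiteY i → 𝔸ˣ) {b₁ : BlockNorm (toB6 (geo9K i) R₀ H₀) F₁} {T : F₁ →ₗ[ℝ] (XSK κ i → ℝ)}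
    {K : IBondY i → IBondY i → ℝ} {s : ℝ} (hs0 : 0 ≤ s) (hs1 : s ≤ 1)
    (h : HasMaj b₁ (bHZP (κ := κ) i b g (R := R₀) (H := H₀) (s := s) hs0 hs1) T K) :
    HasMaj b₁ (bHZPIfam (κ := κ) i b g (R := R₀) (H := H₀) s) T (fun y y' => (geo9K i).len y * K y y') := by
  rw [bHZPIfam_of_mem i b g hs0 hs1]
  exact hasMaj_into_bHZPI_of_bHZP i b g hs0 hs1 h

end SingleExponent

end Literature.MathematicalPhysics.QuantumFieldTheory.Balaban1983to89.B9SmoothHolderClassPProducersR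

end
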